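import Mathlib
import HarnessLib
import Summits.AtomisticToContinuum.FouriersLaw.Theorems.VanishingNoiseTransferNoisyFourierAbelTransfer
import Summits.AtomisticToContinuum.FouriersLaw.Theorems.VanishingNoiseTransferNoisyFourierAbelLimitAux1
import Summits.AtomisticToContinuum.FouriersLaw.Theorems.VanishingNoiseTransferNoisyFourierFlipSectorGap
import Summits.AtomisticToContinuum.FouriersLaw.Theorems.VanishingNoiseTransferNoisyFourierAbelCorrectorExists

/-!
# One-sided Abel monotonicity of the Green–Kubo pairing of the flip-noisy pinned chain, part 1
# (stub `stub_abelMonotone`, line `abel-kapitza-even-corrector`, crux `VanishingNoiseTransfer.NoisyFourier`,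
# stmt-AtomisticToContinuum-11977)

`--supports stmt-AtomisticToContinuum-11977` file (lead c5), part 1 of 2: the twist bound and the corrector
estimates (registered helper `helper_abelCorrectorTwistGe`); part 2 (`…NoisyFourierAbelMonotone`) has the two-point
inequality, the partition argument and the registered stub. Setting as in `…NoisyFourierAbelTransfer`: the pinned
anharmonic chain `𝐏 = pinnedChain ω₂ lam β γ` (parameters `> 0`), `T > 0`, Gibbs measure `μ_T`, flip-noisy
equilibrium generator `L_ε = 𝐏.flipGenerator L T T ε` (`ε > 0`), total current `J = Σ_i j_i`, CLASSICAL Abel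
correctors `u ∈ C² ∩ L²(μ_T)`, `L_ε u = s u − J` pointwise (`s > 0`), and the Abel–Green–Kubo pairing
`σ_L(s) := ∫ J u dμ_T` (independent of the corrector chosen, `resolvent_identity` at `s = s'`).

MAIN RESULT (`abelMonotone`, registered stub `stub_abelMonotone`): there is `C₀` (here `M₁/(4ε²)`, `M₁` the
`L`-uniform half-current second-moment bound `gibbsHalfCurrentSqLe`) such that for all `L ≥ 2`, `0 < a ≤ b` and
correctors `u_a` at `a`, `u_b` at `b`,
  `∫ J u_b dμ_T − ∫ J u_a dμ_T ≥ −C₀ · L · (b − a)`,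
i.e. `s ↦ σ_L(s) + C₀ L s` is NON-DECREASING, uniformly in `L`, with NO Kapitza-type input. This is the free half
of the Abel equicontinuity needed by the Moore–Osgood transfer of the line: given the fixed-`s` thermodynamic
limits it yields `limsup_L σ_L(0⁺)/(L−1) ≤ lim_{s↓0} lim_L σ_L(s)/(L−1)` (the open-chain conductance cannot
exceed the bulk Abel–Green–Kubo conductivity); only the UPPER Abel modulus at `0⁺` remains open.

Proof.
1. TWIST BOUND (`integral_mul_rev_ge_neg`): for `u ∈ C⁰ ∩ L²(μ_T)`, `∫ u·(u∘Π) dμ_T ≥ −∫ (u − P₀u)² dμ_T`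
   (`Π(q,p) = (q,−p)`, `P₀` = average over the `2^L` momentum-sign patterns): pointwise
   `u(x)u(Πx) ≥ −¼(u(x) − u(Πx))²`, `u − u∘Π = d − d∘Π` with `d = u − P₀u` (`P₀u` is `Π`-invariant), and
   `μ_T` is `Π`-invariant. With the flip sector gap (`stub_flipSectorGap`, landed) and the corrector energy bound
   `E(u) := Σ_i ‖u∘F_i − u‖² ≤ L M₁/ε²` (`corrector_flipEnergy_le`): `∫ u·(u∘Π) ≥ −E(u)/4 ≥ −L M₁/(4ε²)`
   for every corrector (`corrector_twist_ge`). (The `Π`-odd part of a corrector is flip-charged, hence free.)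
2. CONTINUITY IN `s` (`corrector_diff_sq_le`): for correctors `u` at `s`, `u'` at `s'`, `v = u' − u` solves
   `L_ε v = s' v − (s − s')u`, so the energy inequality (`corrector_energy_le` with source `(s − s')u`) and
   Cauchy–Schwarz give `s'² ‖v‖² ≤ (s − s')² ‖u‖²`; and `‖u‖² ≤ L M₁/(8 ε s)` (`corrector_normSq_le`).
3. TWO-POINT INEQUALITY (`two_point`): by `resolvent_identity`,
   `σ(s') − σ(s) = (s' − s)∫ u·(u'∘Π) = (s' − s)[∫ u·(u∘Π) + ∫ u·(v∘Π)] ≥ −(s'−s)·L M₁/(4ε²) − (s'−s)²‖u‖²/s'`.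
4. PARTITION (`abelMonotone`): along a uniform partition of `[a,b]` into `n` steps (correctors at the nodes from
   the landed `stub_abelCorrectorExists`) the quadratic errors sum to `O(1/n)`; let `n → ∞`.

References: Bernardin–Olla 2011 §5 (resolvent, `Π`-symmetric/antisymmetric parts), §3 (entropy bound);
Eckmann–Pillet–Rey-Bellet 1999 §3 (`L* = ΠLΠ`); folklore. No definitions; axioms `propext`, `Classical.choice`,
`Quot.sound` only.
-/

noncomputable section

open MeasureTheory Filter Topology
open scoped BigOperators
open Literature.MathematicalPhysics.KineticTheory.HeatConduction
open Summit.AtomisticToContinuum.FouriersLaw.Theorems.SuperadditiveResistance.Kubo (memLp_rev rev rev_apply)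
open Summit.AtomisticToContinuum.FouriersLaw.Theorems.VanishingNoiseBound (gibbs_flipInvariant)
open Summit.AtomisticToContinuum.FouriersLaw.Theorems.NoisyFourier.FlipCeiling (gibbsHalfCurrentSqLe)
open Summit.AtomisticToContinuum.FouriersLaw.Theorems.OddResponseBound.Negative.OddPairing (sq_integral_mul_le)

namespace Summit.AtomisticToContinuum.FouriersLaw.Cruxes.NoisyFourier.AbelKapitzaEvenCorrector

namespace AbelMonotone

open AbelTransfer (memLp_totalCurrent corrector_energy_le corrector_flipEnergy_le resolvent_identity
  memLp_patternAverage integral_rev_gibbsMeasure totalCurrent_neg_momentum abs_integral_mul_totalCurrent_le)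

/-! ## The pattern average is reversal invariant -/

section Patterns

variable {L : ℕ}

/-- The average over the `2^L` momentum-sign patterns is invariant under the full momentum reversal
(reversal permutes the patterns). [folklore] -/
theorem patternSum_rev (u : PhaseSpace L → ℝ) (q p : Fin L → ℝ) :
    (∑ w : Fin L → Bool, u (q, fun i => if w i then -(-p) i else (-p) i)) =
      ∑ w : Fin L → Bool, u (q, fun i => if w i then -p i else p i) := by
  classical
  -- reindex the sum by pointwise negation of the pattern
  set e : (Fin L → Bool) ≃ (Fin L → Bool) :=
    { toFun := fun w i => !w i
      invFun := fun w i => !w i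
      left_inv := fun w => funext fun i => by simp
      right_inv := fun w => funext fun i => by simp } with he
  refine Fintype.sum_equiv e _ _ fun w => ?_
  congr 1
  refine Prod.ext rfl (funext fun i => ?_)
  simp only [he, Equiv.coe_fn_mk, Pi.neg_apply, neg_neg]
  cases w i <;> simp

end Patterns

/-! ## Classical Abel correctors of the flip-noisy pinned chain -/

section Chain

variable {ω₂ lam β γ : ℝ}

/-- **Twist bound.** For `u ∈ C⁰ ∩ L²(μ_T)`: `∫ u·(u∘Π) dμ_T ≥ −∫ (u − P₀u)² dμ_T`, `Π` the momentum reversal,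
`P₀` the pattern average. Pointwise `ab ≥ −¼(a − b)²`, `u − u∘Π = d − d∘Π` for `d = u − P₀u`, and `μ_T∘Π = μ_T`.
[folklore] -/
theorem integral_mul_rev_ge_neg (hω : 0 < ω₂) (hl : 0 ≤ lam) (hβ : 0 ≤ β) (γ : ℝ) (L : ℕ) {T : ℝ}
    (hT : 0 < T) {u : PhaseSpace L → ℝ} (huc : Continuous u)
    (hu2 : MemLp u 2 ((pinnedChain ω₂ lam β γ).gibbsMeasure L T)) :
    -(∫ x, (u x - (∑ w : Fin L → Bool, u (x.1, fun i => if w i then -x.2 i else x.2 i)) / 2 ^ L) ^ 2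
        ∂((pinnedChain ω₂ lam β γ).gibbsMeasure L T)) ≤
      ∫ x, u x * u (x.1, -x.2) ∂((pinnedChain ω₂ lam β γ).gibbsMeasure L T) := by
  set P := pinnedChain ω₂ lam β γ with hP
  set μ := P.gibbsMeasure L T with hμ
  have hflip := gibbs_flipInvariant (ω₂ := ω₂) (lam := lam) (β := β) (γ := γ) L T
  set p : PhaseSpace L → ℝ := fun x =>
    (∑ w : Fin L → Bool, u (x.1, fun i => if w i then -x.2 i else x.2 i)) / 2 ^ L with hp
  have hprev : ∀ x : PhaseSpace L, p ((x.1, -x.2) : PhaseSpace L) = p x := fun x => by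
    simp only [hp]
    rw [patternSum_rev u x.1 x.2]
  have hp2 : MemLp p 2 μ := memLp_patternAverage hflip hu2
  have hru2 : MemLp (fun x : PhaseSpace L => u (x.1, -x.2)) 2 μ := memLp_rev hω hl hβ L hT huc hu2
  -- `d = u - p` and its reversal `dr = u∘Π - p = d∘Π`
  have hd2 : MemLp (fun x => u x - p x) 2 μ := hu2.sub hp2
  have hdr2 : MemLp (fun x : PhaseSpace L => u (x.1, -x.2) - p x) 2 μ := hru2.sub hp2
  have hdrev : ∫ x, (u (x.1, -x.2) - p x) ^ 2 ∂μ = ∫ x, (u x - p x) ^ 2 ∂μ := by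
    have h := integral_rev_gibbsMeasure P T (fun x => (u x - p x) ^ 2)
    refine Eq.trans (integral_congr_ae (ae_of_all _ fun x => ?_)) h
    simp only [hprev x]
  -- pointwise bound
  have hpt : ∀ x : PhaseSpace L,
      -(1 / 2 : ℝ) * ((u x - p x) ^ 2 + (u (x.1, -x.2) - p x) ^ 2) ≤ u x * u (x.1, -x.2) := fun x => by
    nlinarith [sq_nonneg (u x + u (x.1, -x.2)), sq_nonneg ((u x - p x) + (u (x.1, -x.2) - p x))]
  have i1 : Integrable (fun x => (u x - p x) ^ 2) μ := hd2.integrable_sq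
  have i2 : Integrable (fun x : PhaseSpace L => (u (x.1, -x.2) - p x) ^ 2) μ := hdr2.integrable_sq
  have i12 : Integrable (fun x : PhaseSpace L =>
      -(1 / 2 : ℝ) * ((u x - p x) ^ 2 + (u (x.1, -x.2) - p x) ^ 2)) μ := (i1.add i2).const_mul _
  have i3 : Integrable (fun x : PhaseSpace L => u x * u (x.1, -x.2)) μ := hu2.integrable_mul hru2
  have hmono := integral_mono i12 i3 hpt
  rw [integral_const_mul, integral_add i1 i2, hdrev] at hmono
  linarith

/-- **Twist bound by the flip energy**: `∫ u·(u∘Π) dμ_T ≥ −E(u)/4`, `E(u) = Σ_i ∫ (u∘F_i − u)²`, by the flip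
sector gap `4‖u − P₀u‖² ≤ E(u)` (`stub_flipSectorGap`). [folklore] -/
theorem integral_mul_rev_ge_neg_energy (hω : 0 < ω₂) (hl : 0 ≤ lam) (hβ : 0 ≤ β) (γ : ℝ) (L : ℕ) {T : ℝ}
    (hT : 0 < T) {u : PhaseSpace L → ℝ} (huc : Continuous u)
    (hu2 : MemLp u 2 ((pinnedChain ω₂ lam β γ).gibbsMeasure L T)) :
    -((∑ i, ∫ x, (u (momentumFlip i x) - u x) ^ 2 ∂((pinnedChain ω₂ lam β γ).gibbsMeasure L T)) / 4) ≤
      ∫ x, u x * u (x.1, -x.2) ∂((pinnedChain ω₂ lam β γ).gibbsMeasure L T) := by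
  have hflip := gibbs_flipInvariant (ω₂ := ω₂) (lam := lam) (β := β) (γ := γ) L T
  have hgap := stub_flipSectorGap L ((pinnedChain ω₂ lam β γ).gibbsMeasure L T) hflip u hu2
  have htw := integral_mul_rev_ge_neg hω hl hβ γ L hT huc hu2
  linarith

/-- **Twist bound for a corrector**: for a classical Abel corrector `u` at `s ≥ 0` with half-current second
moments `≤ M₁`, `∫ u·(u∘Π) dμ_T ≥ −L M₁/(4ε²)` (`corrector_flipEnergy_le`). [cite: BernardinOlla2011, §3] -/
theorem corrector_twist_ge (hω : 0 < ω₂) (hl : 0 < lam) (hβ : 0 < β) (hγ : 0 < γ) {T : ℝ} (hT : 0 < T)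
    {ε : ℝ} (hε : 0 < ε) {L : ℕ} {s : ℝ} (hs : 0 ≤ s) {u : PhaseSpace L → ℝ} (huC : ContDiff ℝ 2 u)
    (hu2 : MemLp u 2 ((pinnedChain ω₂ lam β γ).gibbsMeasure L T))
    (hpde : ∀ x, (pinnedChain ω₂ lam β γ).flipGenerator L T T ε u x =
      s * u x - ∑ i, (pinnedChain ω₂ lam β γ).bondCurrent L i x)
    {M₁ : ℝ} (hM : ∀ k i j : Fin L,
      MemLp (fun x : PhaseSpace L => x.2 k * deriv (pinnedChain ω₂ lam β γ).V (x.1 j - x.1 i)) 2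
          ((pinnedChain ω₂ lam β γ).gibbsMeasure L T) ∧
        ∫ x, (x.2 k * deriv (pinnedChain ω₂ lam β γ).V (x.1 j - x.1 i)) ^ 2
          ∂((pinnedChain ω₂ lam β γ).gibbsMeasure L T) ≤ M₁) :
    -(L * M₁ / (4 * ε ^ 2)) ≤ ∫ x, u x * u (x.1, -x.2) ∂((pinnedChain ω₂ lam β γ).gibbsMeasure L T) := by
  have hE := corrector_flipEnergy_le hω hl hβ hγ hT hε hs huC hu2 hpde hM
  have htw := integral_mul_rev_ge_neg_energy hω hl.le hβ.le γ L hT huC.continuous hu2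
  have e : (L : ℝ) * M₁ / (4 * ε ^ 2) = (L * M₁ / ε ^ 2) / 4 := by
    field_simp
  rw [e]
  linarith

/-- **Norm bound of a corrector**: for a classical Abel corrector `u` at `s > 0`, `∫ u² dμ_T ≤ L M₁/(8 ε s)`
(energy inequality `s‖u‖² + (ε/2)E(u) ≤ ∫ u J` and the sector bound `|∫ u J| ≤ (2εE(u) + LM₁/(2ε))/4`).
[cite: BernardinOlla2011, §3] -/
theorem corrector_normSq_le (hω : 0 < ω₂) (hl : 0 < lam) (hβ : 0 < β) (hγ : 0 < γ) {T : ℝ} (hT : 0 < T)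
    {ε : ℝ} (hε : 0 < ε) {L : ℕ} {s : ℝ} (hs : 0 < s) {u : PhaseSpace L → ℝ} (huC : ContDiff ℝ 2 u)
    (hu2 : MemLp u 2 ((pinnedChain ω₂ lam β γ).gibbsMeasure L T))
    (hpde : ∀ x, (pinnedChain ω₂ lam β γ).flipGenerator L T T ε u x =
      s * u x - ∑ i, (pinnedChain ω₂ lam β γ).bondCurrent L i x)
    {M₁ : ℝ} (hM : ∀ k i j : Fin L,
      MemLp (fun x : PhaseSpace L => x.2 k * deriv (pinnedChain ω₂ lam β γ).V (x.1 j - x.1 i)) 2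
          ((pinnedChain ω₂ lam β γ).gibbsMeasure L T) ∧
        ∫ x, (x.2 k * deriv (pinnedChain ω₂ lam β γ).V (x.1 j - x.1 i)) ^ 2
          ∂((pinnedChain ω₂ lam β γ).gibbsMeasure L T) ≤ M₁) :
    ∫ x, u x ^ 2 ∂((pinnedChain ω₂ lam β γ).gibbsMeasure L T) ≤ L * M₁ / (8 * ε * s) := by
  have hflip := gibbs_flipInvariant (ω₂ := ω₂) (lam := lam) (β := β) (γ := γ) L T
  have hE := corrector_energy_le hω hl hβ hγ hT ε (memLp_totalCurrent hω hl.le hβ.le γ L hT) huC hu2 hpde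
  have hC := abs_integral_mul_totalCurrent_le (pinnedChain ω₂ lam β γ) hflip hM hu2 (δ := 2 * ε) (by positivity)
  have h1 := le_abs_self
    (∫ x, u x * (∑ i, (pinnedChain ω₂ lam β γ).bondCurrent L i x) ∂((pinnedChain ω₂ lam β γ).gibbsMeasure L T))
  set E := ∑ i, ∫ x, (u (momentumFlip i x) - u x) ^ 2 ∂((pinnedChain ω₂ lam β γ).gibbsMeasure L T) with hEdef
  set N2 := ∫ x, u x ^ 2 ∂((pinnedChain ω₂ lam β γ).gibbsMeasure L T) with hN2
  have e1 : (2 * ε * E + L * M₁ / (2 * ε)) / 4 = ε / 2 * E + L * M₁ / (8 * ε) := by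
    field_simp
    ring
  rw [e1] at hC
  have h2 : s * N2 ≤ L * M₁ / (8 * ε) := by linarith
  rw [le_div_iff₀ (by positivity)]
  rw [le_div_iff₀ (by positivity)] at h2
  calc N2 * (8 * ε * s) = s * N2 * (8 * ε) := by ring
    _ ≤ L * M₁ := h2

/-- **Continuity of correctors in the Abel variable**: for classical Abel correctors `u` at `s` and `u'` at
`s' > 0`, `s'² ∫ (u' − u)² dμ_T ≤ (s − s')² ∫ u² dμ_T` (`v = u' − u` solves `L_ε v = s' v − (s − s')u`; energy
inequality with source `(s − s')u` and Cauchy–Schwarz). [cite: BernardinOlla2011, §5] -/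
theorem corrector_diff_sq_le (hω : 0 < ω₂) (hl : 0 < lam) (hβ : 0 < β) (hγ : 0 < γ) {T : ℝ} (hT : 0 < T)
    {ε : ℝ} (hε : 0 ≤ ε) {L : ℕ} {s s' : ℝ} (hs' : 0 < s') {u u' : PhaseSpace L → ℝ} (huC : ContDiff ℝ 2 u)
    (hu2 : MemLp u 2 ((pinnedChain ω₂ lam β γ).gibbsMeasure L T))
    (hpde : ∀ x, (pinnedChain ω₂ lam β γ).flipGenerator L T T ε u x =
      s * u x - ∑ i, (pinnedChain ω₂ lam β γ).bondCurrent L i x)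
    (hu'C : ContDiff ℝ 2 u') (hu'2 : MemLp u' 2 ((pinnedChain ω₂ lam β γ).gibbsMeasure L T))
    (hpde' : ∀ x, (pinnedChain ω₂ lam β γ).flipGenerator L T T ε u' x =
      s' * u' x - ∑ i, (pinnedChain ω₂ lam β γ).bondCurrent L i x) :
    s' ^ 2 * ∫ x, (u' x - u x) ^ 2 ∂((pinnedChain ω₂ lam β γ).gibbsMeasure L T) ≤
      (s - s') ^ 2 * ∫ x, u x ^ 2 ∂((pinnedChain ω₂ lam β γ).gibbsMeasure L T) := by
  set P := pinnedChain ω₂ lam β γ with hP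
  set μ := P.gibbsMeasure L T with hμ
  -- the difference is a corrector at `s'` with source `(s - s') u`
  have hvC : ContDiff ℝ 2 (fun x => u' x - u x) := hu'C.sub huC
  have hv2 : MemLp (fun x => u' x - u x) 2 μ := hu'2.sub hu2
  have hJv2 : MemLp (fun x => (s - s') * u x) 2 μ := hu2.const_mul _
  have hvpde : ∀ x, P.flipGenerator L T T ε (fun y => u' y - u y) x =
      s' * (u' x - u x) - (s - s') * u x := fun x => by
    rw [flipGenerator_sub' P T T ε hu'C huC x, hpde' x, hpde x]
    ring
  have hE := corrector_energy_le hω hl hβ hγ hT ε hJv2 hvC hv2 hvpde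
  -- Cauchy–Schwarz
  set V := ∫ x, (u' x - u x) ^ 2 ∂μ with hV
  set U := ∫ x, u x ^ 2 ∂μ with hU
  set X := ∫ x, (u' x - u x) * u x ∂μ with hX
  have hV0 : 0 ≤ V := integral_nonneg fun x => sq_nonneg _
  have hU0 : 0 ≤ U := integral_nonneg fun x => sq_nonneg _
  have hCS : X ^ 2 ≤ V * U := sq_integral_mul_le hv2 hu2
  have hsrc : ∫ x, (u' x - u x) * ((s - s') * u x) ∂μ = (s - s') * X := by
    rw [← integral_const_mul]
    exact integral_congr_ae (ae_of_all _ fun x => by ring)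
  rw [hsrc] at hE
  -- drop the (nonnegative) flip energy
  have hflipE : 0 ≤ ε / 2 * ∑ i, ∫ x, ((fun y => u' y - u y) (momentumFlip i x) - (u' x - u x)) ^ 2 ∂μ :=
    mul_nonneg (by positivity) (Finset.sum_nonneg fun i _ => integral_nonneg fun x => sq_nonneg _)
  have h1 : s' * V ≤ (s - s') * X := by linarith
  -- square and compare
  have h2 : (s' * V) ^ 2 ≤ ((s - s') * X) ^ 2 := by
    have h0 : 0 ≤ s' * V := mul_nonneg hs'.le hV0
    exact pow_le_pow_left₀ h0 h1 2
  have h3 : s' ^ 2 * V * V ≤ (s - s') ^ 2 * U * V := by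
    calc s' ^ 2 * V * V = (s' * V) ^ 2 := by ring
      _ ≤ ((s - s') * X) ^ 2 := h2
      _ = (s - s') ^ 2 * X ^ 2 := by ring
      _ ≤ (s - s') ^ 2 * (V * U) := mul_le_mul_of_nonneg_left hCS (sq_nonneg _)
      _ = (s - s') ^ 2 * U * V := by ring
  by_cases hVz : V = 0
  · rw [hVz, mul_zero]
    exact mul_nonneg (sq_nonneg _) hU0
  · have hVpos : 0 < V := lt_of_le_of_ne hV0 (Ne.symm hVz)
    exact le_of_mul_le_mul_right h3 hVpos

end Chain

end AbelMonotone

/-! ## Registered helper -/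

/-- Registered helper sub-goal `helper_abelCorrectorTwistGe` of stub `stub_abelMonotone` (line
`abel-kapitza-even-corrector`, crux stmt-AtomisticToContinuum-11977): the TWIST BOUND for a classical Abel corrector
`u` at `s ≥ 0` of the flip-noisy pinned chain, `−L M₁/(4ε²) ≤ ∫ u·(u∘Π) dμ_T` for half-current second moments
`≤ M₁` (`AbelMonotone.corrector_twist_ge`, notation-free restatement): the `Π`-odd part of a corrector is
flip-charged, hence controlled by the flip Dirichlet energy. [cite: BernardinOlla2011, §3] -/
theorem helper_abelCorrectorTwistGe : ∀ (ω₂ lam β γ T ε : ℝ), 0 < ω₂ → 0 < lam → 0 < β → 0 < γ → 0 < T → 0 < ε → ∀ (L : ℕ) (s : ℝ), 0 ≤ s → ∀ u : Literature.MathematicalPhysics.KineticTheory.HeatConduction.PhaseSpace L → ℝ, ContDiff ℝ 2 u → MeasureTheory.MemLp u 2 ((Literature.MathematicalPhysics.KineticTheory.HeatConduction.pinnedChain ω₂ lam β γ).gibbsMeasure L T) → (∀ x, (Literature.MathematicalPhysics.KineticTheory.HeatConduction.pinnedChain ω₂ lam β γ).flipGenerator L T T ε u x = s * u x - ∑ i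 : Fin L, (Literature.MathematicalPhysics.KineticTheory.HeatConduction.pinnedChain ω₂ lam β γ).bondCurrent L i x) → ∀ (M₁ : ℝ), (∀ k i j : Fin L, MeasureTheory.MemLp (fun x : Literature.MathematicalPhysics.KineticTheory.HeatConduction.PhaseSpace L => x.2 k * deriv (Literature.MathematicalPhysics.KineticTheory.HeatConduction.pinnedChain ω₂ lam β γ).V (x.1 j - x.1 i)) 2 ((Literature.MathematicalPhysics.KineticTheory.HeatConduction.pinnedChain ω₂ lam β γ).gibbsMeasure L T) ∧ MeasureTheory.integral ((Literature.MathematicalPhysics.KineticTheory.HeatConduction.pinnedChain ω₂ lam β γ).gibbsMeasure L T) (fun x => (x.2 k * deriv (Literature.MathematicalPhysics.KineticTheory.HeatConduction.pinnedChain ω₂ lam β γ).V (x.1 j - x.1 i)) ^ 2) ≤ M₁) → -((L : ℝ) * M₁ / (4 * ε ^ 2)) ≤ MeasureTheory.integral ((Literature.MathematicalPhysics.KineticTheory.HeatConduction.pinnedChain ω₂ lam β γ).gibbsMeasure L T) (fun x => u x * u (x.1, -x.2)) :=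
  fun _ _ _ _ _ _ hω hl hβ hγ hT hε _ _ hs _ huC hu2 hpde _ hM =>
    AbelMonotone.corrector_twist_ge hω hl hβ hγ hT hε hs huC hu2 hpde hM

end Summit.AtomisticToContinuum.FouriersLaw.Cruxes.NoisyFourier.AbelKapitzaEvenCorrector

end
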